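import Mathlib
import HarnessLib
import Literature.Analysis.FluidPDE.TypeIAncientMildClassical
import Literature.Analysis.FluidPDE.ClassicalLocalEnergyCutoff
import Summits.NavierStokesRegularity.NavierStokesRegularity.Theorems.SymmetryModuliCountFarPastLedgerLinearFluxLedgerTools

/-!
# Route SymmetryModuliCount — crux `FarPastLedger`, line `uloc-gronwall-transplant`:
  the linear flux ledger (stub LFL)

Theorems file serving the crux item stmt-NavierStokesRegularity-14060
(`Summit.NavierStokesRegularity.NavierStokesRegularity.Theses.SymmetryModuliCount.FarPastLedger`),
line `uloc-gronwall-transplant`, registered stub `stub_fplLinearFluxLedger` (LFL, the lever).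

Let `u ∈ A_C` be a Type-I ancient mild field (`IsTypeIAncientMild C u`) and `(u, p)` a classical
Navier–Stokes pair on the open window `(t₀, 0)`. Assume the near/far structure of the pressure
on every ball `B₂(x₀)` (constant `c₀`), the covering count `∫_{B_ρ} g ≤ 125 ρ³ sup_z ∫_{B₁(z)} g`
and the far-shell sum `∫_{|y−x|≥3} g/|y−x|⁴ ≤ c_S sup_z ∫_{B₁(z)} g` (all three are hypotheses of
the registered signature). If `F₀` majorises the unit-ball energies at the entry time `s'` and
`B ≥ 0` majorises them on `[s', t'] ⊂ (t₀, 0)`, then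
`∫_{B₁(x₀)} |u(t')|² ≤ N F₀ + N B ((t' − s') + C (√(−s') − √(−t')))` with `N = N(c₀, c_S)`.

## Proof

The tree's local energy identity of a classical pair against a time-independent cut-off
(`IsClassicalNSSolutionOn.local_energy_identity_cutoff`) with `φ = φ₀(· − x₀)`, `φ₀` Mathlib's
smooth bump (`= 1` on `B̄₁`, supported in `B₂`, `0 ≤ φ₀ ≤ 1`; its gradient and Laplacian are
bounded by centre-independent constants `c₁, c₂`), between `s' ≤ t'`; the dissipation is dropped.
The flux at time `τ` is bounded linearly in `B` with at most one factor `‖u(τ)‖_∞ ≤ C/√(−τ)`: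
`|∫ Δφ |u|²| ≤ c₂ ∫_{B₃}|u|²`, `|∫ Dφ(u)|u|²| ≤ c₁ (C/√(−τ)) ∫_{B₂}|u|²`; for the pressure,
`∫ Dφ(u) = 0` (`u(τ)` is weakly divergence free), so the constant and `p₂(x₀)` drop out,
`|∫ p₁ Dφ(u)| ≤ ‖p₁‖₂ ‖Dφ(u)‖₂` (Hölder) and `|p₂(x) − p₂(x₀)| ≤ 2 sup_{B₂}‖∇p₂‖` (mean value on
the convex ball). Finally `∫_{s'}^{t'} (K₁ B + K₂ C B (−τ)^{-1/2}) dτ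
= K₁ B (t' − s') + 2 K₂ C B (√(−s') − √(−t'))`.

The slice-wise estimates of the three flux terms, the cut-off and the crossing number live in the
companion tools file `SymmetryModuliCountFarPastLedgerLinearFluxLedgerTools.lean`
(`fpl_LFL_exists_cutoff`, `fpl_LFL_flux_slice_le`, `fpl_LFL_integral_inv_sqrt`); this file
assembles them with the covering count and the far-shell sum and integrates in time.

## References

L. Caffarelli, R. Kohn, L. Nirenberg, CPAM 35 (1982), §2 (the local energy inequality);
the tree file `Literature/Analysis/FluidPDE/ClassicalLocalEnergyCutoff.lean`. Elementary otherwise.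
-/

noncomputable section

open MeasureTheory Set Filter Metric Topology Function
open Literature.Analysis.FluidPDE
open scoped Laplacian RealInnerProductSpace ContDiff

set_option linter.dupNamespace false -- nested layout Summit.<S>.<Sub>, Sub = S (D-0017)

namespace Summit.NavierStokesRegularity.NavierStokesRegularity.Theorems

/-! ### The linear flux ledger -/

/-- **Stub LFL (`stub_fplLinearFluxLedger`), the lever of line `uloc-gronwall-transplant`.**
For `u ∈ A_C` and a classical pair `(u, p)` on the window `(t₀, 0)` with the near/far pressure
structure (constant `c₀`), the covering count and the far-shell sum (constant `c_S`) as
hypotheses: if `F₀` majorises the unit-ball energies at time `s'` and `B ≥ 0` majorises them on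
`[s', t'] ⊂ (t₀, 0)`, then
`∫_{B₁(x₀)} |u(t')|² ≤ N F₀ + N B ((t' − s') + C (√(−s') − √(−t')))`, `N = N(c₀, c_S)`.
Proof: the local energy identity against the cut-off `φ₀(· − x₀)` between `s' ≤ t'`
(`IsClassicalNSSolutionOn.local_energy_identity_cutoff`), dissipation dropped, the flux bounded
at each time by `K₁ B + K₂ C B (−τ)^{-1/2}` (`fpl_LFL_flux_slice_le`), and
`∫_{s'}^{t'} (−τ)^{-1/2} dτ = 2(√(−s') − √(−t'))`. -/
theorem stub_fplLinearFluxLedger :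
    ∀ (c₀ cS : ℝ), ∃ N : ℝ, 0 ≤ N ∧
    ∀ (C : ℝ) (u : ℝ → EuclideanSpace ℝ (Fin 3) → EuclideanSpace ℝ (Fin 3)),
    Literature.Analysis.FluidPDE.IsTypeIAncientMild C u →
    ∀ (t₀ : ℝ) (p : ℝ → EuclideanSpace ℝ (Fin 3) → ℝ),
    Literature.Analysis.FluidPDE.IsClassicalNSSolutionOn (Set.Ioo t₀ 0) 1 0 u p →
    (∀ τ ∈ Set.Ioo t₀ 0, ∀ x₀ : EuclideanSpace ℝ (Fin 3),
      ∃ (c : ℝ) (p₁ p₂ : EuclideanSpace ℝ (Fin 3) → ℝ),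
      (∀ x ∈ Metric.ball x₀ 2, p τ x = c + p₁ x + p₂ x) ∧
      MeasureTheory.MemLp p₁ 2 MeasureTheory.volume ∧
      ∫ x, p₁ x ^ 2 ≤ c₀ * (C ^ 2 / (-τ)) * ∫ x in Metric.ball x₀ 4, ‖u τ x‖ ^ 2 ∧
      ∀ x ∈ Metric.ball x₀ 2, DifferentiableAt ℝ p₂ x ∧
        ‖fderiv ℝ p₂ x‖ ≤ c₀ * ∫ y in (Metric.ball x₀ 3)ᶜ, ‖u τ y‖ ^ 2 / ‖y - x₀‖ ^ 4) →
    (∀ (ρ : ℝ), 1 ≤ ρ → ∀ (g : EuclideanSpace ℝ (Fin 3) → ℝ), Continuous g → (∀ x, 0 ≤ g x) →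
      ∀ (B : ℝ) (x₁ : EuclideanSpace ℝ (Fin 3)),
      (∀ z : EuclideanSpace ℝ (Fin 3), ∫ x in Metric.ball z 1, g x ≤ B) →
      ∫ x in Metric.ball x₁ ρ, g x ≤ 125 * ρ ^ 3 * B) →
    (∀ (g : EuclideanSpace ℝ (Fin 3) → ℝ), Continuous g → (∀ x, 0 ≤ g x) → (∃ M : ℝ, ∀ x, g x ≤ M) →
      ∀ (B : ℝ) (x₁ : EuclideanSpace ℝ (Fin 3)),
      (∀ z : EuclideanSpace ℝ (Fin 3), ∫ x in Metric.ball z 1, g x ≤ B) →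
      MeasureTheory.IntegrableOn (fun y => g y / ‖y - x₁‖ ^ 4) (Metric.ball x₁ 3)ᶜ
          MeasureTheory.volume ∧
        ∫ y in (Metric.ball x₁ 3)ᶜ, g y / ‖y - x₁‖ ^ 4 ≤ cS * B) →
    ∀ (s' t' : ℝ), t₀ < s' → s' ≤ t' → t' < 0 → ∀ (F₀ B : ℝ), 0 ≤ B →
    (∀ z : EuclideanSpace ℝ (Fin 3), ∫ x in Metric.ball z 1, ‖u s' x‖ ^ 2 ≤ F₀) →
    (∀ τ ∈ Set.Icc s' t', ∀ z : EuclideanSpace ℝ (Fin 3), ∫ x in Metric.ball z 1, ‖u τ x‖ ^ 2 ≤ B) →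
    ∀ x₀ : EuclideanSpace ℝ (Fin 3),
      ∫ x in Metric.ball x₀ 1, ‖u t' x‖ ^ 2 ≤
        N * F₀ + N * B * ((t' - s') + C * (Real.sqrt (-s') - Real.sqrt (-t'))) := by
  intro c₀ cS
  obtain ⟨c₁, c₂, hc₁0, hc₂0, hcut⟩ := fpl_LFL_exists_cutoff
  obtain ⟨V, hVdef⟩ : ∃ V : ℝ, V = volume.real (ball (0 : EuclideanSpace ℝ (Fin 3)) 2) := ⟨_, rfl⟩
  have hV0 : 0 ≤ V := by rw [hVdef]; exact measureReal_nonneg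
  obtain ⟨K₀, hK₀def⟩ : ∃ K : ℝ, K = Real.sqrt (|c₀| * 8000 * (c₁ ^ 2 * 1000)) := ⟨_, rfl⟩
  have hK₀0 : 0 ≤ K₀ := by rw [hK₀def]; exact Real.sqrt_nonneg _
  obtain ⟨K₁, hK₁def⟩ : ∃ K : ℝ, K = 3375 * c₂ := ⟨_, rfl⟩
  obtain ⟨K₂, hK₂def⟩ : ∃ K : ℝ, K = 1000 * c₁ + 2 * K₀ + 4 * |c₀| * |cS| * c₁ * V := ⟨_, rfl⟩
  have hK₁0 : 0 ≤ K₁ := by rw [hK₁def]; positivity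
  have hK₂0 : 0 ≤ K₂ := by rw [hK₂def]; positivity
  refine ⟨1000 + K₁ + 2 * K₂, by positivity, ?_⟩
  intro C u hu t₀ p hNS hNF hCOV hSHELL s' t' hs' hst ht' F₀ B hB hF₀ hBτ x₀
  obtain ⟨φ, hφ, hφc, hφ0, hφ1, hφball1, hφ2, hφc₁, hφc₂⟩ := hcut x₀
  have hC0 : 0 ≤ C := hu.nonneg
  have hs'0 : s' < 0 := lt_of_le_of_lt hst ht'
  have hI : Icc s' t' ⊆ Ioo t₀ 0 := fun τ hτ => ⟨hs'.trans_le hτ.1, hτ.2.trans_lt ht'⟩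
  -- (a) the unit ball at the exit time `t'`
  have hvt : Continuous (u t') := hu.continuous_slice ht'
  have ha : ∫ x in ball x₀ 1, ‖u t' x‖ ^ 2 ≤ ∫ x, φ x * ‖u t' x‖ ^ 2 := by
    have i : Integrable (fun x => φ x * ‖u t' x‖ ^ 2) volume :=
      (hφ.continuous.mul (hvt.norm.pow 2)).integrable_of_hasCompactSupport
        (fpl_LFL_hasCompactSupport fun z hz => by
          show φ z * ‖u t' z‖ ^ 2 = 0
          rw [hφ2 z hz, zero_mul])
    calc ∫ x in ball x₀ 1, ‖u t' x‖ ^ 2 = ∫ x in ball x₀ 1, φ x * ‖u t' x‖ ^ 2 :=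
          setIntegral_congr_fun measurableSet_ball fun z hz => by rw [hφball1 z hz, one_mul]
      _ ≤ ∫ x, φ x * ‖u t' x‖ ^ 2 :=
          setIntegral_le_integral i (Eventually.of_forall fun z => mul_nonneg (hφ0 z) (sq_nonneg _))
  -- (b) the entry deposit at time `s'`
  have hvs : Continuous (u s') := hu.continuous_slice hs'0
  have hb : ∫ x, φ x * ‖u s' x‖ ^ 2 ≤ 1000 * F₀ := by
    have h1 : ∫ x, φ x * ‖u s' x‖ ^ 2 ≤ 1 * ∫ x in ball x₀ 2, ‖u s' x‖ ^ 2 :=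
      fpl_LFL_integral_le_mul_setIntegral
        (fpl_LFL_integrableOn_ball (hφ.continuous.mul (hvs.norm.pow 2)) x₀ 2)
        (fpl_LFL_integrableOn_ball (hvs.norm.pow 2) x₀ 2)
        (fun z _ => mul_le_mul_of_nonneg_right (hφ1 z) (sq_nonneg _))
        (fun z hz => by rw [hφ2 z hz, zero_mul])
    have h2 : ∫ x in ball x₀ 2, ‖u s' x‖ ^ 2 ≤ 125 * 2 ^ 3 * F₀ :=
      hCOV 2 (by norm_num) (fun x => ‖u s' x‖ ^ 2) (hvs.norm.pow 2) (fun x => sq_nonneg _) F₀ x₀ hF₀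
    linarith
  -- (c) the flux at each time `τ ∈ [s', t']`
  have hflux : ∀ τ ∈ Icc s' t',
      ∫ z, (1 * ((Δ φ) z * ‖u τ z‖ ^ 2) + fderiv ℝ φ z (u τ z) * ‖u τ z‖ ^ 2 +
        2 * (p τ z * fderiv ℝ φ z (u τ z))) ≤ K₁ * B + K₂ * (C * B) * (Real.sqrt (-τ))⁻¹ := by
    intro τ hτ
    have hτS : τ ∈ Ioo t₀ 0 := hI hτ
    have hτ0 : τ < 0 := hτS.2
    have hnτ : 0 < -τ := by linarith
    have hsq : 0 < Real.sqrt (-τ) := Real.sqrt_pos.2 hnτ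
    obtain ⟨M, hMdef⟩ : ∃ M : ℝ, M = C / Real.sqrt (-τ) := ⟨_, rfl⟩
    have hM : 0 ≤ M := by rw [hMdef]; exact div_nonneg hC0 hsq.le
    have hvM : ∀ z, ‖u τ z‖ ≤ M := fun z => by rw [hMdef]; exact hu.norm_le hτ0 z
    have hv : Continuous (u τ) := hu.continuous_slice hτ0
    have hq : Continuous (p τ) := (hNS.contDiff_pressure hτS).continuous
    have hdiv : IsWeaklyDivFree (u τ) := hu.isWeaklyDivFree hτ0
    obtain ⟨c, p₁, p₂, hdec, hp₁, hX, hp₂⟩ := hNF τ hτS x₀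
    have hg0 : ∀ x, 0 ≤ ‖u τ x‖ ^ 2 := fun x => sq_nonneg _
    have hgc : Continuous fun x => ‖u τ x‖ ^ 2 := hv.norm.pow 2
    have hB2 : ∫ x in ball x₀ 2, ‖u τ x‖ ^ 2 ≤ 125 * 2 ^ 3 * B :=
      hCOV 2 (by norm_num) _ hgc hg0 B x₀ (hBτ τ hτ)
    have hB3 : ∫ x in ball x₀ 3, ‖u τ x‖ ^ 2 ≤ 125 * 3 ^ 3 * B :=
      hCOV 3 (by norm_num) _ hgc hg0 B x₀ (hBτ τ hτ)
    have hB4 : ∫ x in ball x₀ 4, ‖u τ x‖ ^ 2 ≤ 125 * 4 ^ 3 * B :=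
      hCOV 4 (by norm_num) _ hgc hg0 B x₀ (hBτ τ hτ)
    have hSh : ∫ y in (ball x₀ 3)ᶜ, ‖u τ y‖ ^ 2 / ‖y - x₀‖ ^ 4 ≤ cS * B :=
      (hSHELL _ hgc hg0 ⟨M ^ 2, fun x => pow_le_pow_left₀ (norm_nonneg _) (hvM x) 2⟩ B x₀
        (hBτ τ hτ)).2
    have hI0 : 0 ≤ ∫ y in (ball x₀ 3)ᶜ, ‖u τ y‖ ^ 2 / ‖y - x₀‖ ^ 4 :=
      setIntegral_nonneg measurableSet_ball.compl fun y _ => by positivity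
    have hL : c₀ * ∫ y in (ball x₀ 3)ᶜ, ‖u τ y‖ ^ 2 / ‖y - x₀‖ ^ 4 ≤ |c₀| * |cS| * B :=
      calc c₀ * ∫ y in (ball x₀ 3)ᶜ, ‖u τ y‖ ^ 2 / ‖y - x₀‖ ^ 4
          ≤ |c₀| * ∫ y in (ball x₀ 3)ᶜ, ‖u τ y‖ ^ 2 / ‖y - x₀‖ ^ 4 :=
            mul_le_mul_of_nonneg_right (le_abs_self _) hI0
        _ ≤ |c₀| * (cS * B) := mul_le_mul_of_nonneg_left hSh (abs_nonneg _)
        _ ≤ |c₀| * (|cS| * B) :=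
            mul_le_mul_of_nonneg_left (mul_le_mul_of_nonneg_right (le_abs_self _) hB)
              (abs_nonneg _)
        _ = |c₀| * |cS| * B := by ring
    have hVx : volume.real (ball x₀ 2) ≤ V := by
      rw [hVdef, Measure.addHaar_real_ball_center volume x₀ 2]
    have key := fpl_LFL_flux_slice_le hφ hφc hφ0 hφ2 hφc₁ hφc₂ hv hdiv hM hvM hq hdec hp₁ hp₂ hVx
    -- the near-pressure square roots
    have hXb : ∫ z, p₁ z ^ 2 ≤ |c₀| * 8000 * (C ^ 2 / (-τ)) * B := by
      refine hX.trans ?_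
      calc c₀ * (C ^ 2 / (-τ)) * ∫ x in ball x₀ 4, ‖u τ x‖ ^ 2
          ≤ |c₀| * (C ^ 2 / (-τ)) * ∫ x in ball x₀ 4, ‖u τ x‖ ^ 2 :=
            mul_le_mul_of_nonneg_right (mul_le_mul_of_nonneg_right (le_abs_self _)
              (by positivity)) (setIntegral_nonneg measurableSet_ball fun x _ => hg0 x)
        _ ≤ |c₀| * (C ^ 2 / (-τ)) * (125 * 4 ^ 3 * B) :=
            mul_le_mul_of_nonneg_left hB4 (by positivity)
        _ = |c₀| * 8000 * (C ^ 2 / (-τ)) * B := by ring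
    have hYb : c₁ ^ 2 * ∫ z in ball x₀ 2, ‖u τ z‖ ^ 2 ≤ c₁ ^ 2 * 1000 * B := by
      calc c₁ ^ 2 * ∫ z in ball x₀ 2, ‖u τ z‖ ^ 2 ≤ c₁ ^ 2 * (125 * 2 ^ 3 * B) :=
            mul_le_mul_of_nonneg_left hB2 (sq_nonneg _)
        _ = c₁ ^ 2 * 1000 * B := by ring
    have hsqrt := fpl_LFL_sqrt_mul_sqrt_le (integral_nonneg fun z => sq_nonneg _)
      (mul_nonneg (sq_nonneg _) (setIntegral_nonneg measurableSet_ball fun x _ => hg0 x))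
      (by positivity) (by positivity) hB hC0 hnτ hXb hYb
    rw [← hK₀def] at hsqrt
    -- the common factor `Q = C B (−τ)^{-1/2}`
    obtain ⟨Q, hQdef⟩ : ∃ Q : ℝ, Q = C * B * (Real.sqrt (-τ))⁻¹ := ⟨_, rfl⟩
    have hQ : C * B / Real.sqrt (-τ) = Q := by rw [hQdef, div_eq_mul_inv]
    have hMB : M * B = Q := by rw [hMdef, hQdef, div_eq_mul_inv]; ring
    rw [hQ] at hsqrt
    have e1 : c₂ * ∫ z in ball x₀ 3, ‖u τ z‖ ^ 2 ≤ K₁ * B :=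
      calc c₂ * ∫ z in ball x₀ 3, ‖u τ z‖ ^ 2 ≤ c₂ * (125 * 3 ^ 3 * B) :=
            mul_le_mul_of_nonneg_left hB3 hc₂0
        _ = K₁ * B := by rw [hK₁def]; ring
    have e2 : c₁ * M * ∫ z in ball x₀ 2, ‖u τ z‖ ^ 2 ≤ 1000 * c₁ * Q :=
      calc c₁ * M * ∫ z in ball x₀ 2, ‖u τ z‖ ^ 2 ≤ c₁ * M * (125 * 2 ^ 3 * B) :=
            mul_le_mul_of_nonneg_left hB2 (mul_nonneg hc₁0 hM)
        _ = 1000 * c₁ * (M * B) := by ring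
        _ = 1000 * c₁ * Q := by rw [hMB]
    have e3 : 2 * (Real.sqrt (∫ z, p₁ z ^ 2) *
        Real.sqrt (c₁ ^ 2 * ∫ z in ball x₀ 2, ‖u τ z‖ ^ 2)) ≤ 2 * K₀ * Q := by
      rw [mul_assoc 2 K₀ Q]
      exact mul_le_mul_of_nonneg_left hsqrt zero_le_two
    have e4 : 4 * (c₀ * ∫ y in (ball x₀ 3)ᶜ, ‖u τ y‖ ^ 2 / ‖y - x₀‖ ^ 4) * (c₁ * M) * V ≤
        4 * |c₀| * |cS| * c₁ * V * Q :=
      calc 4 * (c₀ * ∫ y in (ball x₀ 3)ᶜ, ‖u τ y‖ ^ 2 / ‖y - x₀‖ ^ 4) * (c₁ * M) * V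
          ≤ 4 * (|c₀| * |cS| * B) * (c₁ * M) * V :=
            mul_le_mul_of_nonneg_right (mul_le_mul_of_nonneg_right
              (mul_le_mul_of_nonneg_left hL (by norm_num)) (mul_nonneg hc₁0 hM)) hV0
        _ = 4 * |c₀| * |cS| * c₁ * V * (M * B) := by ring
        _ = 4 * |c₀| * |cS| * c₁ * V * Q := by rw [hMB]
    have eK : K₂ * (C * B) * (Real.sqrt (-τ))⁻¹ =
        1000 * c₁ * Q + 2 * K₀ * Q + 4 * |c₀| * |cS| * c₁ * V * Q := by
      rw [mul_assoc, ← hQdef, hK₂def]; ring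
    rw [eK]
    linarith [key, e1, e2, e3, e4]
  -- (d) integrate the energy identity in time, drop the dissipation
  have hId := hNS.local_energy_identity_cutoff isOpen_Ioo hφ hφc hst hI
  have hdiss : 0 ≤ ∫ τ in s'..t', ∫ z, frobeniusNormSq (fderiv ℝ (u τ) z) * φ z :=
    intervalIntegral.integral_nonneg hst fun τ _ =>
      integral_nonneg fun z => mul_nonneg (frobeniusNormSq_nonneg _) (hφ0 z)
  have hI' : uIcc s' t' ⊆ Ioo t₀ 0 := by rwa [uIcc_of_le hst]
  have hFint : IntervalIntegrable (fun τ => ∫ z, (1 * ((Δ φ) z * ‖u τ z‖ ^ 2) +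
      fderiv ℝ φ z (u τ z) * ‖u τ z‖ ^ 2 + 2 * (p τ z * fderiv ℝ φ z (u τ z)))) volume s' t' :=
    ((hNS.continuousOn_integral_flux_cutoff hφ hφc).mono hI').intervalIntegrable
  have hGint : IntervalIntegrable (fun τ => K₁ * B + K₂ * (C * B) * (Real.sqrt (-τ))⁻¹)
      volume s' t' :=
    intervalIntegrable_const.add ((fpl_LFL_intervalIntegrable_inv_sqrt s' t' hst ht').const_mul _)
  have hmono := intervalIntegral.integral_mono_on hst hFint hGint hflux
  have hG : ∫ τ in s'..t', (K₁ * B + K₂ * (C * B) * (Real.sqrt (-τ))⁻¹) =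
      (t' - s') * (K₁ * B) + K₂ * (C * B) * (2 * (Real.sqrt (-s') - Real.sqrt (-t'))) := by
    rw [intervalIntegral.integral_add intervalIntegrable_const
        ((fpl_LFL_intervalIntegrable_inv_sqrt s' t' hst ht').const_mul _),
      intervalIntegral.integral_const, intervalIntegral.integral_const_mul,
      fpl_LFL_integral_inv_sqrt s' t' hst ht', smul_eq_mul]
  rw [hG] at hmono
  -- (e) conclude
  have hδ : 0 ≤ Real.sqrt (-s') - Real.sqrt (-t') :=
    sub_nonneg.2 (Real.sqrt_le_sqrt (by linarith))
  have hF₀0 : 0 ≤ F₀ :=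
    (setIntegral_nonneg measurableSet_ball fun x _ => sq_nonneg _).trans (hF₀ x₀)
  have f1 : 1000 * F₀ ≤ (1000 + K₁ + 2 * K₂) * F₀ :=
    mul_le_mul_of_nonneg_right (by linarith) hF₀0
  have f2 : K₁ * (B * (t' - s')) ≤ (1000 + K₁ + 2 * K₂) * (B * (t' - s')) :=
    mul_le_mul_of_nonneg_right (by linarith) (mul_nonneg hB (sub_nonneg.2 hst))
  have f3 : 2 * K₂ * (B * (C * (Real.sqrt (-s') - Real.sqrt (-t')))) ≤
      (1000 + K₁ + 2 * K₂) * (B * (C * (Real.sqrt (-s') - Real.sqrt (-t')))) :=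
    mul_le_mul_of_nonneg_right (by linarith) (by positivity)
  linarith [ha, hb, hId, hdiss, hmono, f1, f2, f3]

end Summit.NavierStokesRegularity.NavierStokesRegularity.Theorems

end
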